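import Summits.AnomalousDissipation.AnomalousDissipation.Theses.TaylorCertificates
import Summits.AnomalousDissipation.AnomalousDissipation.Theorems.KolmogorovFloorEnsembleCeiling.Negative.Planar
import HarnessLib

/-!
# Route TaylorCertificates — the support `TargetImpliesSteady`

Proof of the route declaration
`Summit.AnomalousDissipation.AnomalousDissipation.Theses.TaylorCertificates.TargetImpliesSteady`
(item stmt-AnomalousDissipation-14883): the route target `X = FloorCertificateEnsembleCeiling`
(ONE smooth divergence-free mean-zero force `f` and `ε₀, E, ν₀ > 0` carrying, at every
`ν ∈ (0, ν₀)`, an unrestricted floor certificate on the finite-enstrophy part of the Leray ball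
AND the ensemble energy ceiling `E` for stationary statistical solutions) implies route item #3
`SteadyStatesLoudBounded` FOR THE SAME FORCE and the same constants: at every `ν ∈ (0, ν₀)` every
smooth classical steady state `u` of `NS_ν(f)` has `ε₀ ≤ ν‖∇u‖²` and `∫ |u|² ≤ E`.

The `∀ ν`-body of `X` is, definitionally, `FloorFamily f ε₀ ν ∧ ceiling` (cf.
`FloorCertificate.Negative.floorCertificate_iff`), and the landed
`KolmogorovFloorEnsembleCeiling.Negative.loudBoundedSteadyAt_of_floor_ceiling` (Dirac case of weak
duality: at a steady state the generator pairing and `(f,u) − ν‖∇u‖²` vanish, so the floor reads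
`ε₀ ≤ ν‖∇u‖²`; the Dirac mass at a steady state is a stationary statistical solution, so the
ceiling gives `∫ |u|² ≤ E`) turns it into `LoudBoundedSteadyAt f ε₀ E ν`, which is the `∀ ν`-body
of item #3 verbatim.
-/

namespace Summit.AnomalousDissipation.AnomalousDissipation.Theorems

-- the mandated namespace `Summit.<Summit>.<Problem>.Theorems` repeats `AnomalousDissipation` (single-problem summit)
set_option linter.dupNamespace false

open Summit.AnomalousDissipation.AnomalousDissipation.Theses.TaylorCertificates
open Summit.AnomalousDissipation.AnomalousDissipation.Theorems.KolmogorovFloorEnsembleCeiling.Negative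

/-- **The target implies loud-and-bounded steady states, for the same force.**
`FloorCertificateEnsembleCeiling → SteadyStatesLoudBounded`: keep the witness force `f` and the
constants `ε₀, E, ν₀`; at each `ν ∈ (0, ν₀)` the target's body is a floor family together with the
ensemble ceiling, and `loudBoundedSteadyAt_of_floor_ceiling` makes every smooth classical steady
state of `NS_ν(f)` `ε₀`-loud and `E`-bounded. Closes item stmt-AnomalousDissipation-14883. -/
theorem TargetImpliesSteady_proof :
    Summit.AnomalousDissipation.AnomalousDissipation.Theses.TaylorCertificates.TargetImpliesSteady := by
  unfold TargetImpliesSteady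
  rintro ⟨f, hf₁, hf₂, hf₃, ε₀, E, ν₀, hε, hν₀, h⟩
  refine ⟨f, hf₁, hf₂, hf₃, ε₀, E, ν₀, hε, hν₀, fun ν hν hνν => ?_⟩
  obtain ⟨hfl, hceil⟩ := h ν hν hνν
  exact loudBoundedSteadyAt_of_floor_ceiling hf₁ hν hfl hceil

end Summit.AnomalousDissipation.AnomalousDissipation.Theorems
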